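import Summits.BirchSwinnertonDyer.BirchSwinnertonDyer.Theorems.AdditiveBranchIMCGordTwoRankZeroLambdaAdicIff
import Summits.BirchSwinnertonDyer.Rank1Residual.Additive.GordRankZeroKatoComponentTower
import Summits.BirchSwinnertonDyer.Rank1Residual.Additive.N10IsogenyTransport
import Summits.BirchSwinnertonDyer.Rank1Residual.Additive.TypeGThree
import Literature.NumberTheory.EllipticCurves.Kato2004.BigImageDivisibilityCyclotomicPrimeComponentOfHalf
import HarnessLib

/-!
# Route `AdditiveBranchIMC` (rung K1), crux `GordTwoRankZeroOffCaseOne` (item 19357): the rank-ZERO booking door on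
# X4♯(G-ord, `e = 2`) ∩ surj at EVERY odd prime — `p = 3` INCLUDED — from the lower half alone
# (cell `bsd-addord`, seat `bsd-addord-k1-c2` gen 6, D-0074 row B1)

HONEST FRAMING. THEOREMS ONLY: no definition, no named fact, no `sorry`, nothing booked; BSD is not proved by any of
this; the crux stays OPEN at class level (the lower half below is a HYPOTHESIS `hlow`, discharged per pair by the
companion records). What this file adds: on cell (G-ord, `e = 2`) the UPPER half `ord_p #Ш(E) ≤ ord_p #Ш(E)_an` in
analytic rank `0` needs only `ρ̄_{E,p}` onto — at `p = 3` too — because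
* the `p`-adic TOWER `ρ_{E,p^n}` onto follows from `ρ̄_{E,p}` onto on this cell for every odd `p`, `p = 3` included
  (gen 0's `towerSurj_of_surj_cellGordTwo` = the tree's PROVED Greenberg 1991 §2 / Wuthrich 2014 App. B argument on the
  good ordinary twist model `E^{(p*)}`, `Wuthrich2014/ThreeAdicImageOrdinaryProofs.lean`), and
* additive-p2's `ClassX4Gord.missingUpperBoundAt_rankZero_of_katoComponent_of_towerSurj` turns the tower into the upper
  half from Kato's component divisibility `hK` (Kato 2004 Thm. 17.4 (3) read on the branch), Delbourgo 1998 Prop. 4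
  `hDel98`, GZK and modularity — NO Tamagawa, NO Manin, NO (ram), NO `p ≥ 5`.
Hence `BSD(E,p)` on X4♯(G-ord, `e = 2`) ∩ surj ∩ `r_an = 0` ⟸ `MissingLowerBoundAt W p` (`bsdp_rankZero_of_cellGordTwo_of_surj_of_lower`),
in the booking-table currency `ClassX4Gord W p` + `semistabilityIndex W p = 2` (`…_of_classX4Gord_…`), at `p = 3` with
`e = 2` automatic (`…_three_…`), and in ISOGENY-CLASS form (Cassels, `hCassels`). The gen-4/5 rank-zero doors of this seat
(`bsdp_rankZero_surj_of_companionWitness`, `…_of_shaAnUnit`) reach `p ≥ 5` only (they go through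
`Addv.missingUpperBoundAt_rankZero_of_semistableTwist_of_surj`, hypothesis `5 ≤ p`); this door is their `p = 3` completion
and is what turns the seat's 303 lower-half companion records at `p = 3` (`missingLowerBoundAt_c<E>_3`, θ proved in the
kernel since gen 6) into `BSD(E,3)` per pair on the surj(3) rows.
References: [Kato2004Asterisque] Thm. 17.4 (3) (p. 273); [Delbourgo1998] Prop. 4 (p. 144); [Greenberg1991] §2 (p. 214);
[Wuthrich2014] App. B; [Serre1972] §4; [MilneADT2006] Thm. I.7.3; [Miller2011LMS] Def. 1.1.
-/

noncomputable section

open scoped Classical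

open WeierstrassCurve Literature.NumberTheory.EllipticCurves
  Literature.NumberTheory.EllipticCurves.ModularForms
  Literature.NumberTheory.EllipticCurves.Rank1Residual
  Literature.NumberTheory.EllipticCurves.Rank1Residual.Typed
  Literature.NumberTheory.GaloisRepresentations

set_option linter.dupNamespace false

namespace Summit.BirchSwinnertonDyer.BirchSwinnertonDyer.Theorems.AdditiveBranchIMCGordTwoRankZeroCompanion

open Summit.BirchSwinnertonDyer.Rank1Residual
open Summit.BirchSwinnertonDyer.Rank1Residual.Additive
open Summit.BirchSwinnertonDyer.BirchSwinnertonDyer.Theorems.AdditiveBranchIMCGordTwoRankZeroLambdaAdicIff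

section ThreeDoor

variable {W : WeierstrassCurve ℚ} [W.IsElliptic] [W.IsGloballyMinimal] {p : ℕ} [hp : Fact p.Prime]

/-- **UPPER half on cell (G-ord, `e = 2`) ∩ surj, `r_an = 0`, EVERY odd `p` (`p = 3` included):**
`ord_p #Ш(E) ≤ ord_p #Ш(E)_an` from Kato's component divisibility (`hK`), Delbourgo 1998 Prop. 4 (`hDel98`), GZK and
modularity — the tower hypothesis of additive-p2's theorem discharged by `towerSurj_of_surj_cellGordTwo` (Greenberg 1991 /
Wuthrich App. B on the good ordinary twist, proved in the tree). No Tamagawa / Manin / (ram) / `p ≥ 5` hypothesis.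
[cite: Kato2004Asterisque, Thm. 17.4 (3) (p. 273)] [cite: Delbourgo1998, Prop. 4 (p. 144)] [cite: Greenberg1991, §2 (p. 214)] -/
theorem missingUpperBoundAt_rankZero_of_cellGordTwo_of_surj
    (hK : Kato2004.charIdeal_dvd_padicLFunctionBranch_component_of_surjective)
    (hDel98 : Delbourgo1998.prop4_rankZero_pow_dvd_constantCoeff)
    (hGZK : rank_eq_analyticRank_of_analyticRank_le_one) (hmod : hasEntireLFunction_rat)
    (hmodD : nonempty_modularParametrizationData)
    (hc : N10.CellGordTwo W p) (hsurj : Surj W p) (hr : W.analyticRank = 0) : MissingUpperBoundAt W p :=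
  ClassX4Gord.missingUpperBoundAt_rankZero_of_katoComponent_of_towerSurj hK hDel98 hGZK hmod hmodD
    ⟨⟨hc.1, hc.2.1, hasIrreducibleModPGaloisRep_of_hasSurjectiveModNGaloisRep W p hsurj⟩, hc.2.2.1⟩ hc.2.2.2 hr
    (towerSurj_of_surj_cellGordTwo hc hsurj)

/-- **The rank-ZERO door, every odd `p`: `BSD(E,p)` on cell (G-ord, `e = 2`) ∩ surj ∩ `r_an = 0` FROM THE LOWER HALF**
(`hlow : MissingLowerBoundAt W p` — the crux's conclusion at the pair, e.g. a companion record) — upper half by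
`missingUpperBoundAt_rankZero_of_cellGordTwo_of_surj`. [cite: Kato2004Asterisque, Thm. 17.4 (3) (p. 273)]
[cite: Delbourgo1998, Prop. 4 (p. 144)] [cite: Miller2011LMS, §1 and Def. 1.1] -/
theorem bsdp_rankZero_of_cellGordTwo_of_surj_of_lower
    (hK : Kato2004.charIdeal_dvd_padicLFunctionBranch_component_of_surjective)
    (hDel98 : Delbourgo1998.prop4_rankZero_pow_dvd_constantCoeff)
    (hGZK : rank_eq_analyticRank_of_analyticRank_le_one) (hmod : hasEntireLFunction_rat)
    (hmodD : nonempty_modularParametrizationData)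
    (hc : N10.CellGordTwo W p) (hsurj : Surj W p) (hr : W.analyticRank = 0) (hlow : MissingLowerBoundAt W p) :
    BSDp W p :=
  bsdp_of_missingPPartAt W p hGZK (by rw [hr]; exact zero_le_one)
    (missingPPartAt_of_lower_of_upper W p hlow
      (missingUpperBoundAt_rankZero_of_cellGordTwo_of_surj hK hDel98 hGZK hmod hmodD hc hsurj hr))

/-- **The same door in the booking-table currency** `ClassX4Gord W p` + `semistabilityIndex W p = 2` (X4♯(G-ord) ∩ `I₀*`;
the currency of the cell's X4♯ offers), every odd `p`. [cite: Kato2004Asterisque, Thm. 17.4 (3) (p. 273)]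
[cite: Delbourgo1998, Prop. 4 (p. 144)] [cite: Miller2011LMS, §1 and Def. 1.1] -/
theorem bsdp_rankZero_of_classX4Gord_of_surj_of_lower
    (hK : Kato2004.charIdeal_dvd_padicLFunctionBranch_component_of_surjective)
    (hDel98 : Delbourgo1998.prop4_rankZero_pow_dvd_constantCoeff)
    (hGZK : rank_eq_analyticRank_of_analyticRank_le_one) (hmod : hasEntireLFunction_rat)
    (hmodD : nonempty_modularParametrizationData)
    (hX : ClassX4Gord W p) (he : semistabilityIndex W p = 2) (hsurj : Surj W p) (hr : W.analyticRank = 0)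
    (hlow : MissingLowerBoundAt W p) : BSDp W p :=
  bsdp_rankZero_of_cellGordTwo_of_surj_of_lower hK hDel98 hGZK hmod hmodD ⟨hX.addv.1, hX.addv.2, hX.typeGOrd, he⟩ hsurj
    hr hlow

/-- **ISOGENY-CLASS form (the booking unit is the class):** for every globally minimal `E'` `ℚ`-isogenous to the door's
member `E` (X4♯(G-ord) ∩ `I₀*` ∩ surj at the odd prime `p`, `r_an(E) = 0`, lower half at `E`), `BSD(E',p)` — Cassels'
isogeny invariance of the BSD quotient (`hCassels`, the cell's `N10.bsdp_of_isIsogenous_of_bsdp`; the analytic rank is an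
isogeny invariant unconditionally). [cite: MilneADT2006, Thm. I.7.3 and Remark I.7.4]
[cite: Kato2004Asterisque, Thm. 17.4 (3) (p. 273)] [cite: Delbourgo1998, Prop. 4 (p. 144)] [cite: Miller2011LMS, §1 and Def. 1.1] -/
theorem isogenous_bsdp_rankZero_of_classX4Gord_of_surj_of_lower
    (hCassels : bsdRHS_eq_of_isIsogenous)
    (hK : Kato2004.charIdeal_dvd_padicLFunctionBranch_component_of_surjective)
    (hDel98 : Delbourgo1998.prop4_rankZero_pow_dvd_constantCoeff)
    (hGZK : rank_eq_analyticRank_of_analyticRank_le_one) (hmod : hasEntireLFunction_rat)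
    (hmodD : nonempty_modularParametrizationData)
    {W' : WeierstrassCurve ℚ} [W'.IsElliptic] [W'.IsGloballyMinimal] (hiso : IsIsogenous W' W)
    (hX : ClassX4Gord W p) (he : semistabilityIndex W p = 2) (hsurj : Surj W p) (hr : W.analyticRank = 0)
    (hlow : MissingLowerBoundAt W p) : BSDp W' p := by
  have hr' : W'.analyticRank ≤ 1 := by rw [analyticRank_eq_of_isIsogenous' hiso, hr]; exact zero_le_one
  exact N10.bsdp_of_isIsogenous_of_bsdp p hCassels hGZK hmod hiso hr'
    (bsdp_rankZero_of_classX4Gord_of_surj_of_lower hK hDel98 hGZK hmod hmodD hX he hsurj hr hlow)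

end ThreeDoor

section Three

variable {W : WeierstrassCurve ℚ} [W.IsElliptic] [W.IsGloballyMinimal]

/-- **`p = 3`: `BSD(E,3)` on X4♯(G-ord) ∩ surj(3) ∩ `r_an = 0` FROM THE LOWER HALF** — at `p = 3` the semistability
index of a (G)-type additive prime is `2` automatically (`semistabilityIndex_eq_two_of_typeG_three`), so the door takes
`ClassX4Gord W 3`, `Surj W 3` (mod-`3` image onto; the `3`-adic tower follows on this cell), `r_an = 0` and the lower half
only. [cite: Kato2004Asterisque, Thm. 17.4 (3) (p. 273)] [cite: Delbourgo1998, Prop. 4 (p. 144)]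
[cite: Greenberg1991, §2 (p. 214)] [cite: Miller2011LMS, §1 and Def. 1.1] -/
theorem bsdp_rankZero_three_of_classX4Gord_of_surj_of_lower
    (hK : Kato2004.charIdeal_dvd_padicLFunctionBranch_component_of_surjective)
    (hDel98 : Delbourgo1998.prop4_rankZero_pow_dvd_constantCoeff)
    (hGZK : rank_eq_analyticRank_of_analyticRank_le_one) (hmod : hasEntireLFunction_rat)
    (hmodD : nonempty_modularParametrizationData)
    (hX : ClassX4Gord W 3) (hsurj : Surj W 3) (hr : W.analyticRank = 0) (hlow : MissingLowerBoundAt W 3) :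
    BSDp W 3 :=
  bsdp_rankZero_of_classX4Gord_of_surj_of_lower hK hDel98 hGZK hmod hmodD hX
    (semistabilityIndex_eq_two_of_typeG_three W hX.typeGOrd.typeG hX.addv.2) hsurj hr hlow

/-- **`p = 3`, ISOGENY-CLASS form**: `BSD(E',3)` for every globally minimal `E'` `ℚ`-isogenous to the door's member `E`
(X4♯(G-ord) ∩ surj(3), `r_an(E) = 0`, lower half at `E`). [cite: MilneADT2006, Thm. I.7.3 and Remark I.7.4]
[cite: Kato2004Asterisque, Thm. 17.4 (3) (p. 273)] [cite: Delbourgo1998, Prop. 4 (p. 144)] [cite: Miller2011LMS, §1 and Def. 1.1] -/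
theorem isogenous_bsdp_rankZero_three_of_classX4Gord_of_surj_of_lower
    (hCassels : bsdRHS_eq_of_isIsogenous)
    (hK : Kato2004.charIdeal_dvd_padicLFunctionBranch_component_of_surjective)
    (hDel98 : Delbourgo1998.prop4_rankZero_pow_dvd_constantCoeff)
    (hGZK : rank_eq_analyticRank_of_analyticRank_le_one) (hmod : hasEntireLFunction_rat)
    (hmodD : nonempty_modularParametrizationData)
    {W' : WeierstrassCurve ℚ} [W'.IsElliptic] [W'.IsGloballyMinimal] (hiso : IsIsogenous W' W)
    (hX : ClassX4Gord W 3) (hsurj : Surj W 3) (hr : W.analyticRank = 0) (hlow : MissingLowerBoundAt W 3) :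
    BSDp W' 3 :=
  isogenous_bsdp_rankZero_of_classX4Gord_of_surj_of_lower hCassels hK hDel98 hGZK hmod hmodD hiso hX
    (semistabilityIndex_eq_two_of_typeG_three W hX.typeGOrd.typeG hX.addv.2) hsurj hr hlow

end Three

/-! ### §2 (gen 6, append) The same doors from the REGISTER fact `hK` (Wuthrich 2014 / Kato half-eigenspace reading)

`Kato2004.charIdeal_dvd_padicLFunctionBranch_component_of_surjective` is RETIRED as a separate named fact (b2b referee
ruling R118.3): it is a kernel consequence of `Wuthrich2014.kato_halfEigenCharIdeal_dvd_cyclotomicPrime_of_surjective` via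
`Kato2004.charIdeal_dvd_padicLFunctionBranch_component_of_surjective_of_half` (p236713). The `_of_katoHalf` forms below take the
register fact `hK` — the binder set of the cell's booked rank-zero companion doors (`bsdp_c<E>_5`: hK hDel98 hPal hGZK hmod hmodD)
minus `hPal`. -/

section KatoHalf

variable {W : WeierstrassCurve ℚ} [W.IsElliptic] [W.IsGloballyMinimal] {p : ℕ} [hp : Fact p.Prime]

/-- **UPPER half on cell (G-ord, `e = 2`) ∩ surj, `r_an = 0`, every odd `p` (`p = 3` included), from the register fact `hK`**
(Kato 2004 Thm. 17.4 (3) in Wuthrich's half-eigenspace reading; the component reading is derived in the kernel).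
[cite: Kato2004Asterisque, Thm. 17.4 (3) (p. 273)] [cite: Wuthrich2014, §3 (p. 390)] [cite: Delbourgo1998, Prop. 4 (p. 144)]
[cite: Greenberg1991, §2 (p. 214)] -/
theorem missingUpperBoundAt_rankZero_of_cellGordTwo_of_surj_of_katoHalf
    (hK : Wuthrich2014.kato_halfEigenCharIdeal_dvd_cyclotomicPrime_of_surjective)
    (hDel98 : Delbourgo1998.prop4_rankZero_pow_dvd_constantCoeff)
    (hGZK : rank_eq_analyticRank_of_analyticRank_le_one) (hmod : hasEntireLFunction_rat)
    (hmodD : nonempty_modularParametrizationData)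
    (hc : N10.CellGordTwo W p) (hsurj : Surj W p) (hr : W.analyticRank = 0) : MissingUpperBoundAt W p :=
  missingUpperBoundAt_rankZero_of_cellGordTwo_of_surj
    (Kato2004.charIdeal_dvd_padicLFunctionBranch_component_of_surjective_of_half hK) hDel98 hGZK hmod hmodD hc hsurj hr

/-- **The rank-ZERO door from the register fact `hK`, every odd `p`: `BSD(E,p)` on cell (G-ord, `e = 2`) ∩ surj ∩ `r_an = 0`
FROM THE LOWER HALF.** [cite: Kato2004Asterisque, Thm. 17.4 (3) (p. 273)] [cite: Wuthrich2014, §3 (p. 390)]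
[cite: Delbourgo1998, Prop. 4 (p. 144)] [cite: Miller2011LMS, §1 and Def. 1.1] -/
theorem bsdp_rankZero_of_cellGordTwo_of_surj_of_lower_of_katoHalf
    (hK : Wuthrich2014.kato_halfEigenCharIdeal_dvd_cyclotomicPrime_of_surjective)
    (hDel98 : Delbourgo1998.prop4_rankZero_pow_dvd_constantCoeff)
    (hGZK : rank_eq_analyticRank_of_analyticRank_le_one) (hmod : hasEntireLFunction_rat)
    (hmodD : nonempty_modularParametrizationData)
    (hc : N10.CellGordTwo W p) (hsurj : Surj W p) (hr : W.analyticRank = 0) (hlow : MissingLowerBoundAt W p) :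
    BSDp W p :=
  bsdp_rankZero_of_cellGordTwo_of_surj_of_lower
    (Kato2004.charIdeal_dvd_padicLFunctionBranch_component_of_surjective_of_half hK) hDel98 hGZK hmod hmodD hc hsurj hr hlow

/-- **Booking-table currency, register fact `hK`**: `BSD(E,p)` on X4♯(G-ord) ∩ `I₀*` ∩ surj ∩ `r_an = 0` from the lower half,
every odd `p`. [cite: Kato2004Asterisque, Thm. 17.4 (3) (p. 273)] [cite: Wuthrich2014, §3 (p. 390)] [cite: Delbourgo1998, Prop. 4 (p. 144)]
[cite: Miller2011LMS, §1 and Def. 1.1] -/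
theorem bsdp_rankZero_of_classX4Gord_of_surj_of_lower_of_katoHalf
    (hK : Wuthrich2014.kato_halfEigenCharIdeal_dvd_cyclotomicPrime_of_surjective)
    (hDel98 : Delbourgo1998.prop4_rankZero_pow_dvd_constantCoeff)
    (hGZK : rank_eq_analyticRank_of_analyticRank_le_one) (hmod : hasEntireLFunction_rat)
    (hmodD : nonempty_modularParametrizationData)
    (hX : ClassX4Gord W p) (he : semistabilityIndex W p = 2) (hsurj : Surj W p) (hr : W.analyticRank = 0)
    (hlow : MissingLowerBoundAt W p) : BSDp W p :=
  bsdp_rankZero_of_classX4Gord_of_surj_of_lower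
    (Kato2004.charIdeal_dvd_padicLFunctionBranch_component_of_surjective_of_half hK) hDel98 hGZK hmod hmodD hX he hsurj hr hlow

/-- **ISOGENY-CLASS form, register fact `hK`**, every odd `p`. [cite: MilneADT2006, Thm. I.7.3 and Remark I.7.4]
[cite: Kato2004Asterisque, Thm. 17.4 (3) (p. 273)] [cite: Wuthrich2014, §3 (p. 390)] [cite: Miller2011LMS, §1 and Def. 1.1] -/
theorem isogenous_bsdp_rankZero_of_classX4Gord_of_surj_of_lower_of_katoHalf
    (hCassels : bsdRHS_eq_of_isIsogenous)
    (hK : Wuthrich2014.kato_halfEigenCharIdeal_dvd_cyclotomicPrime_of_surjective)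
    (hDel98 : Delbourgo1998.prop4_rankZero_pow_dvd_constantCoeff)
    (hGZK : rank_eq_analyticRank_of_analyticRank_le_one) (hmod : hasEntireLFunction_rat)
    (hmodD : nonempty_modularParametrizationData)
    {W' : WeierstrassCurve ℚ} [W'.IsElliptic] [W'.IsGloballyMinimal] (hiso : IsIsogenous W' W)
    (hX : ClassX4Gord W p) (he : semistabilityIndex W p = 2) (hsurj : Surj W p) (hr : W.analyticRank = 0)
    (hlow : MissingLowerBoundAt W p) : BSDp W' p :=
  isogenous_bsdp_rankZero_of_classX4Gord_of_surj_of_lower hCassels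
    (Kato2004.charIdeal_dvd_padicLFunctionBranch_component_of_surjective_of_half hK) hDel98 hGZK hmod hmodD hiso hX he hsurj
    hr hlow

end KatoHalf

section KatoHalfThree

variable {W : WeierstrassCurve ℚ} [W.IsElliptic] [W.IsGloballyMinimal]

/-- **`p = 3`, register fact `hK`: `BSD(E,3)` on X4♯(G-ord) ∩ surj(3) ∩ `r_an = 0` FROM THE LOWER HALF** (`e = 2` automatic at `3`).
[cite: Kato2004Asterisque, Thm. 17.4 (3) (p. 273)] [cite: Wuthrich2014, §3 (p. 390)] [cite: Delbourgo1998, Prop. 4 (p. 144)]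
[cite: Greenberg1991, §2 (p. 214)] [cite: Miller2011LMS, §1 and Def. 1.1] -/
theorem bsdp_rankZero_three_of_classX4Gord_of_surj_of_lower_of_katoHalf
    (hK : Wuthrich2014.kato_halfEigenCharIdeal_dvd_cyclotomicPrime_of_surjective)
    (hDel98 : Delbourgo1998.prop4_rankZero_pow_dvd_constantCoeff)
    (hGZK : rank_eq_analyticRank_of_analyticRank_le_one) (hmod : hasEntireLFunction_rat)
    (hmodD : nonempty_modularParametrizationData)
    (hX : ClassX4Gord W 3) (hsurj : Surj W 3) (hr : W.analyticRank = 0) (hlow : MissingLowerBoundAt W 3) :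
    BSDp W 3 :=
  bsdp_rankZero_three_of_classX4Gord_of_surj_of_lower
    (Kato2004.charIdeal_dvd_padicLFunctionBranch_component_of_surjective_of_half hK) hDel98 hGZK hmod hmodD hX hsurj hr hlow

/-- **`p = 3`, ISOGENY-CLASS form, register fact `hK`.** [cite: MilneADT2006, Thm. I.7.3 and Remark I.7.4]
[cite: Kato2004Asterisque, Thm. 17.4 (3) (p. 273)] [cite: Wuthrich2014, §3 (p. 390)] [cite: Miller2011LMS, §1 and Def. 1.1] -/
theorem isogenous_bsdp_rankZero_three_of_classX4Gord_of_surj_of_lower_of_katoHalf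
    (hCassels : bsdRHS_eq_of_isIsogenous)
    (hK : Wuthrich2014.kato_halfEigenCharIdeal_dvd_cyclotomicPrime_of_surjective)
    (hDel98 : Delbourgo1998.prop4_rankZero_pow_dvd_constantCoeff)
    (hGZK : rank_eq_analyticRank_of_analyticRank_le_one) (hmod : hasEntireLFunction_rat)
    (hmodD : nonempty_modularParametrizationData)
    {W' : WeierstrassCurve ℚ} [W'.IsElliptic] [W'.IsGloballyMinimal] (hiso : IsIsogenous W' W)
    (hX : ClassX4Gord W 3) (hsurj : Surj W 3) (hr : W.analyticRank = 0) (hlow : MissingLowerBoundAt W 3) :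
    BSDp W' 3 :=
  isogenous_bsdp_rankZero_three_of_classX4Gord_of_surj_of_lower hCassels
    (Kato2004.charIdeal_dvd_padicLFunctionBranch_component_of_surjective_of_half hK) hDel98 hGZK hmod hmodD hiso hX hsurj hr hlow

end KatoHalfThree

/-! ### §3 (gen 6, append) What remains of `BSD(E,p)` on these rows is EXACTLY the lower half — `p = 3` included, no
`j`-witness / surj(9) certificate (cf. additive-p2's `ClassX4Gord.missingInputAt_iff_lower_three_of_katoComponent_of_cert`,
whose tower certificate is now discharged by `towerSurj_of_surj_cellGordTwo`) -/

section Remains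

variable {W : WeierstrassCurve ℚ} [W.IsElliptic] [W.IsGloballyMinimal] {p : ℕ} [hp : Fact p.Prime]

/-- **Cell (G-ord, `e = 2`) ∩ surj ∩ `r_an = 0`, every odd `p` (`p = 3` included): the missing `p`-part of BSD is EXACTLY the
lower half** — `X4.MissingInputAt W p ↔ MissingLowerBoundAt W p` (the crux's conclusion at the pair), from the register fact `hK`
+ `hDel98` + GZK + modularity; the tower hypothesis of additive-p2's iff discharged from `ρ̄_{E,p}` onto.
[cite: Kato2004Asterisque, Thm. 17.4 (3) (p. 273)] [cite: Wuthrich2014, §3 (p. 390)] [cite: Delbourgo1998, Prop. 4 (p. 144)]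
[cite: Greenberg1991, §2 (p. 214)] -/
theorem missingInputAt_iff_lower_rankZero_of_cellGordTwo_of_surj_of_katoHalf
    (hK : Wuthrich2014.kato_halfEigenCharIdeal_dvd_cyclotomicPrime_of_surjective)
    (hDel98 : Delbourgo1998.prop4_rankZero_pow_dvd_constantCoeff)
    (hGZK : rank_eq_analyticRank_of_analyticRank_le_one) (hmod : hasEntireLFunction_rat)
    (hmodD : nonempty_modularParametrizationData)
    (hc : N10.CellGordTwo W p) (hsurj : Surj W p) (hr : W.analyticRank = 0) :
    X4.MissingInputAt W p ↔ MissingLowerBoundAt W p :=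
  ClassX4Gord.missingInputAt_iff_lower_rankZero_of_katoComponent_of_towerSurj
    (Kato2004.charIdeal_dvd_padicLFunctionBranch_component_of_surjective_of_half hK) hDel98 hGZK hmod hmodD
    ⟨⟨hc.1, hc.2.1, hasIrreducibleModPGaloisRep_of_hasSurjectiveModNGaloisRep W p hsurj⟩, hc.2.2.1⟩ hc.2.2.2 hr
    (towerSurj_of_surj_cellGordTwo hc hsurj)

end Remains

section RemainsThree

variable {W : WeierstrassCurve ℚ} [W.IsElliptic] [W.IsGloballyMinimal]

/-- **`p = 3`, X4♯(G-ord) ∩ surj(3) ∩ `r_an = 0`: what remains of `BSD(E,3)` is EXACTLY the lower half** — the (3, X4♯, r0)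
end-state row of the cell's N11 / B3 ledger WITHOUT the `j`-witness-or-surj(9) certificate of
`ClassX4Gord.missingInputAt_iff_lower_three_of_katoComponent_of_cert` (`e = 2` automatic at `3`).
[cite: Kato2004Asterisque, Thm. 17.4 (3) (p. 273)] [cite: Wuthrich2014, §3 (p. 390)] [cite: Delbourgo1998, Prop. 4 (p. 144)]
[cite: Greenberg1991, §2 (p. 214)] -/
theorem missingInputAt_iff_lower_rankZero_three_of_classX4Gord_of_surj_of_katoHalf
    (hK : Wuthrich2014.kato_halfEigenCharIdeal_dvd_cyclotomicPrime_of_surjective)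
    (hDel98 : Delbourgo1998.prop4_rankZero_pow_dvd_constantCoeff)
    (hGZK : rank_eq_analyticRank_of_analyticRank_le_one) (hmod : hasEntireLFunction_rat)
    (hmodD : nonempty_modularParametrizationData)
    (hX : ClassX4Gord W 3) (hsurj : Surj W 3) (hr : W.analyticRank = 0) :
    X4.MissingInputAt W 3 ↔ MissingLowerBoundAt W 3 :=
  missingInputAt_iff_lower_rankZero_of_cellGordTwo_of_surj_of_katoHalf hK hDel98 hGZK hmod hmodD
    ⟨hX.addv.1, hX.addv.2, hX.typeGOrd, semistabilityIndex_eq_two_of_typeG_three W hX.typeGOrd.typeG hX.addv.2⟩ hsurj hr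

end RemainsThree

end Summit.BirchSwinnertonDyer.BirchSwinnertonDyer.Theorems.AdditiveBranchIMCGordTwoRankZeroCompanion

end
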